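import Literature.NumberTheory.GaloisRepresentations.HeckeCharacter
import Literature.NumberTheory.Automorphic.AdeleBaseChange
import Literature.NumberTheory.Automorphic.GaloisActionPlaces
import HarnessLib

/-!
# Extension of unitary idele class characters along a quadratic extension, with unramifiedness on a
# prescribed Galois-admissible set of places (Pontryagin duality, Hewitt–Ross (24.12)) — named fact

Topic `Literature/NumberTheory/GaloisRepresentations` (Hecke characters; siblings `HeckeCharacter`,
`HeckeCharacterArchTypeProofs` — the Baer/Weil extension engine of the tree —, `GlobalArtinMapNormProofs`
— `compRelNorm`, the NORM form `ω ∘ N_{K/F₀}`).  This file vendors (D-0014) the RESTRICTION form of the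
existence of Hecke characters of `K` with prescribed restriction to the ideles of `F₀`:

**Statement.**  `K/F₀` quadratic with non-trivial automorphism `c`; `χ₀` a UNITARY Hecke character of
`F₀`; `U` a set of finite places of `K` which is `c`-admissible for `χ₀` in the sense: whenever both
`u` and `c • u` lie in `U`, `χ₀` is unramified at the place `u ∩ 𝓞 F₀` below.  Then there is a unitary
Hecke character `χ` of `K` with `χ ∘ BC = χ₀` on `𝕀_{F₀}` (`AdeleRing.ideleBaseChange`) and `χ`
unramified at every `u ∈ U`.

**Why it is true** (the derivation recorded for the auditor; no single source prints this exact
packaging).  In `C_K = 𝕀_K/Kˣ` let `H` be the image of `C_{F₀}` — injective (`Kˣ ∩ 𝕀_{F₀} = F₀ˣ` by Galois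
descent) and CLOSED (the norm `C_K → C_{F₀}` composed with the inclusion is `x ↦ x²`-like, `‖x_K‖_K = ‖x‖²`,
so the inclusion is proper; Cassels–Fröhlich Ch. II §16–18) — and `C` the image of the COMPACT
`∏_{u ∈ U} 𝒪_uˣ`; `H · C` is closed.  The character `h · z ↦ χ₀(h)` on `H · C` is well defined: if an
`F₀`-idele `x` satisfies `x_K = p · z` with `p ∈ Kˣ` and `z` a unit idele supported on `U`, apply `c`:
`p / c(p) = c(z) / z` has archimedean part `1`, hence `p = c(p) ∈ F₀ˣ`; absorbing `p` into `x`, `x` is a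
unit idele of `F₀` supported on the places `v` ALL of whose extensions to `K` lie in `U` — i.e. `w = c • w ∈ U`
(`v` inert or ramified) or `w, c • w ∈ U` (`v` split) — where `χ₀` is unramified by admissibility, so
`χ₀(x) = 1` (at a split `v` with only one of `w, c • w` in `U` the component `x_v = z_{c • w} = 1`).  It is
continuous (open mapping theorem for the σ-compact `H × C → H · C`) and unitary, so it extends to a
continuous unitary character of the locally compact abelian `C_K` by Hewitt–Ross, Thm. (24.12) ("every
continuous character of a closed subgroup of a locally compact abelian group extends to a continuous
character of the whole group", a corollary of the Pontryagin duality theorem (24.8)); the extension is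
`χ`.  The admissibility hypothesis is also NECESSARY (for `u, c • u ∈ U` the restriction of an unramified
pair is unramified).  NB: when `χ₀,v(-1) = -1` at a real place `v` of `F₀` that is complex in `K`, every
such `χ` has infinite order, even for `χ₀` of finite order (the value `-1` must be produced by the
connected `ℂˣ`), so the open-kernel device of Clozel–Harris–Taylor Lemma 4.1.1 does not apply.

Consumers: the crux `QuadraticWindow.HostInducedRep` (stmt-Langlands-10902, line `one-transparent-pane`):
fact-stub `stub_factExt`, consumed by `stub_memberSatake` / `memberSatake_objects`
(Theorems/QuadraticWindowHostInducedRepMemberSatake*.lean) to lift the unitary-type twist `ψ₀` from the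
totally real `F₀` to the CM quadratic `K` — there only the case `F₀` totally real, `K` totally complex is
used, which is dischargeable from the tree's Baer/Weil extension engine (`HeckeCharacterArchTypeProofs`
§2–§4) without duality (evidence report `stub_factExt.report.md` on the item, Route T).

STATUS: PROVED — `HewittRoss_heckeCharacter_extension_quadratic_holds`
(`HeckeCharacterExtensionQuadraticGeneralProofs.lean`), in full generality and still without the duality
theorem for locally compact abelian groups (absent from Mathlib): Weil's extension principle
(`HeckeCharacter.exists_extension_of_key`, `…WeilProofs`) with the obstruction character on the norm-one
units `k / c k` killed by a product-form archimedean character chosen through Dirichlet's unit theorem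
(`exists_archParams_prod_archUnitaryValue_unit_eq`); the CM / finite-order special case is
`HeckeCharacter.exists_extension_quadratic_of_isTotallyComplex_of_isFiniteOrder` (`…CMProofs`).

What is NOT here: the proof (see STATUS above); the Pontryagin duality theorem itself (Mathlib has only
the definition `PontryaginDual` and its topology); the norm form (Clozel–Harris–Taylor 2008 Lemma 4.1.4, BLGGT Lemma
A.2.5), which is `HeckeCharacter.compRelNorm` business; archimedean types of the extension.

## References

* E. Hewitt, K. A. Ross, *Abstract Harmonic Analysis I*, 2nd ed., Grundlehren 115, Springer (1979),
  Thm. (24.12) (with (24.8), (24.11)). [HewittRoss1979]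
* J. W. S. Cassels, A. Fröhlich (eds.), *Algebraic Number Theory* (1967), Ch. II (Cassels, *Global
  fields*) §16–§18: ideles, the idele class group, compactness of `C_K¹`, the norm map. [CasselsFrohlichANT1967]
* L. Clozel, M. Harris, R. Taylor, *Automorphy for some ℓ-adic lifts of automorphic mod ℓ Galois
  representations*, Publ. Math. IHÉS 108 (2008), Lemma 4.1.1 and Lemma 4.1.4 (nearest printed
  number-theoretic statements; norm form). [ClozelHarrisTaylor2008]

## Mathlib / tree search

`lean search 'Pontryagin|exists_extension.*Character|ideleBaseChange.*HeckeCharacter'`: Mathlib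
`PontryaginDual` (definition, local compactness) and `Analysis.Fourier.FiniteAbelian.PontryaginDuality`
(finite groups only); tree: `HeckeCharacter.compRelNorm` (norm form), `HeckeCharacter.exists_isUnitary_infiniteIdeles_eq`,
`Subgroup.exists_monoidHom_extension(_eq_one)` (algebraic Baer extension), `AdeleRing.isClosed_range_ideleBaseChange`,
`AdeleRing.mem_range_ideleBaseChange_iff` (Galois descent) — no restriction-form existence statement; added here.
-/

noncomputable section

open scoped NumberField
open NumberField IsDedekindDomain
open Literature.NumberTheory.Automorphic

namespace Literature.NumberTheory.GaloisRepresentations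

/-- **Extension of a unitary idele class character along a quadratic extension with prescribed
unramifiedness (Hewitt–Ross (24.12) applied to `C_{F₀} ↪ C_K` and `∏_{u∈U} 𝒪_uˣ`).**  For a quadratic
extension `K/F₀` of number fields with non-trivial `F₀`-automorphism `c`, a unitary Hecke character `χ₀`
of `F₀`, and a set `U` of finite places of `K` such that `χ₀` is unramified below `u` whenever both `u`
and `c • u` lie in `U`: there is a unitary Hecke character `χ` of `K` whose restriction to the ideles of
`F₀` (through `AdeleRing.ideleBaseChange F₀ K`) is `χ₀` and which is unramified at every place of `U`.
(Derivation from the duality theorem in the module docstring.)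
[cite: HewittRoss1979, Thm. (24.12)] [cite: CasselsFrohlichANT1967, Ch. II §16–§18] -/
def HewittRoss_heckeCharacter_extension_quadratic : Prop :=
  ∀ (F₀ K : Type) [Field F₀] [NumberField F₀] [Field K] [NumberField K] [Algebra F₀ K]
    (c : K ≃ₐ[F₀] K), Module.finrank F₀ K = 2 → c ≠ 1 →
    ∀ (χ₀ : HeckeCharacter F₀), χ₀.IsUnitary →
    ∀ (U : Set (HeightOneSpectrum (𝓞 K))),
      (∀ u ∈ U, c • u ∈ U → χ₀.IsUnramifiedAt (u.under (𝓞 F₀))) →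
      ∃ χ : HeckeCharacter K, χ.IsUnitary ∧
        (∀ x, χ (AdeleRing.ideleBaseChange F₀ K x) = χ₀ x) ∧ ∀ u ∈ U, χ.IsUnramifiedAt u

/-- Unfolding lemma for `HewittRoss_heckeCharacter_extension_quadratic` (the body is VERBATIM the
fact-stub `stub_factExt` of the crux `QuadraticWindow.HostInducedRep` and the hypothesis `hext` of its
laundering theorems). [folklore] -/
theorem HewittRoss_heckeCharacter_extension_quadratic_iff :
    HewittRoss_heckeCharacter_extension_quadratic ↔
      ∀ (F₀ K : Type) [Field F₀] [NumberField F₀] [Field K] [NumberField K] [Algebra F₀ K]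
        (c : K ≃ₐ[F₀] K), Module.finrank F₀ K = 2 → c ≠ 1 →
        ∀ (χ₀ : HeckeCharacter F₀), χ₀.IsUnitary →
        ∀ (U : Set (HeightOneSpectrum (𝓞 K))),
          (∀ u ∈ U, c • u ∈ U → χ₀.IsUnramifiedAt (u.under (𝓞 F₀))) →
          ∃ χ : HeckeCharacter K, χ.IsUnitary ∧
            (∀ x, χ (AdeleRing.ideleBaseChange F₀ K x) = χ₀ x) ∧ ∀ u ∈ U, χ.IsUnramifiedAt u :=
  Iff.rfl

/-- **The unconstrained case** (`U = ∅`): every unitary Hecke character of `F₀` is the restriction of a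
unitary Hecke character of the quadratic `K` — the bare extension statement, as a consequence of the fact.
[cite: HewittRoss1979, Thm. (24.12)] -/
theorem HewittRoss_heckeCharacter_extension_quadratic.exists_restrict_eq
    (h : HewittRoss_heckeCharacter_extension_quadratic) (F₀ K : Type) [Field F₀] [NumberField F₀]
    [Field K] [NumberField K] [Algebra F₀ K] (c : K ≃ₐ[F₀] K) (h2 : Module.finrank F₀ K = 2)
    (hc : c ≠ 1) (χ₀ : HeckeCharacter F₀) (hχ₀ : χ₀.IsUnitary) :
    ∃ χ : HeckeCharacter K, χ.IsUnitary ∧ ∀ x, χ (AdeleRing.ideleBaseChange F₀ K x) = χ₀ x := by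
  obtain ⟨χ, hχ, hres, -⟩ := h F₀ K c h2 hc χ₀ hχ₀ ∅ (fun u hu _ ↦ (Set.notMem_empty u hu).elim)
  exact ⟨χ, hχ, hres⟩

end Literature.NumberTheory.GaloisRepresentations

end
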